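import Summits.KontsevichZagierPeriods.KontsevichZagierPeriods.Theorems.SoloInformedLastSubst
import Summits.KontsevichZagierPeriods.KontsevichZagierPeriods.Theorems.SoloInformedEquidimJunk
import Literature.ModelTheory.ExponentialFields.CylindricalDecomposition
import HarnessLib
import HarnessLib.Audit

/-!
# SoloInformed — sheets: monotone last-coordinate substitution on vertically convex pieces (Newton–Leibniz elimination, file 3c)

Solo programme `solo-KontsevichZagierPeriods-informed`, session s245 (K-NF, `paper/nl-elimination.md`
§7.2, FILE 3).

File 3a (`SoloInformedLastSubst`) realises `Ψ_G(x,t) = (x, G(x,t))` as a change of variables in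
`relations₁₂` GIVEN injectivity.  Here injectivity is derived from the sign of the Jacobian on
pieces whose vertical fibres are intervals: if every fibre `{t | (x,t) ∈ D}` is convex and
`∂_t G > 0` on `D`, then `G` is strictly increasing on each fibre and `Ψ_G` is injective on `D`.
This yields the two kinds of sheets of the Newton–Leibniz elimination:

* positive sheets `soloInformed_of_sub_of_posSheet_mem`: `[D, f] − [Ψ_F(D), 1] ∈ relations₁₂` when
  `f = ∂_t F > 0` on `D` (`F` differentiable at the points of `D`, `ℚ`-semialgebraic on `D`);
* negative sheets `soloInformed_of_add_of_negSheet_mem`: `[D, f] + [Ψ_F(D), 1] ∈ relations₁₂` when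
  `f = ∂_t F < 0` on `D`;
* the fibres of bands `bandOver S ξ j` and of slabs `{p ≤ t ≤ q}` are convex
  (`soloInformed_convex_fibre_bandOver`, `soloInformed_convex_fibre_slab`), and the fibrewise
  derivative is the last partial derivative (`soloInformed_hasDerivAt_fibre`,
  `soloInformed_fderiv_single_last_eq`; the velocity of the vertical line is inlined, cf.
  `KZexp.hasDerivAt_snoc`).

References: M. Kontsevich, D. Zagier, *Periods* (2001), §1.2; Basu–Pollack–Roy (2006), Def. 5.1;
this work (THEOREM NF, `paper/nl-elimination.md` §2 Steps 1–2).
-/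

noncomputable section

open scoped BigOperators Topology

namespace Summit.KontsevichZagierPeriods.KontsevichZagierPeriods.Theorems

open Set MeasureTheory Filter Function
open Literature.ModelTheory.ExponentialFields
open Literature.NumberTheory.Transcendental Literature.NumberTheory.Transcendental.KZ

variable {n : ℕ}

/-! ### The vertical line and the fibrewise derivative -/

/-- **Fibrewise derivative = last partial derivative**: if `F` has Fréchet derivative `φ` at
`z = (x, t)` then `s ↦ F (x, s)` has derivative `φ e_last` at `t`. [folklore] -/
theorem soloInformed_hasDerivAt_fibre {F : (Fin (n + 1) → ℝ) → ℝ} {φ : (Fin (n + 1) → ℝ) →L[ℝ] ℝ}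
    {z : Fin (n + 1) → ℝ} (hd : HasFDerivAt F φ z) :
    HasDerivAt (fun s : ℝ => F (Fin.snoc (Fin.init z) s)) (φ (Pi.single (Fin.last n) 1))
      (z (Fin.last n)) := by
  -- the vertical line `s ↦ (init z, s)` has velocity `e_last` (cf. `KZexp.hasDerivAt_snoc`)
  have h1 : HasDerivAt (fun s : ℝ => (Fin.snoc (Fin.init z) s : Fin (n + 1) → ℝ))
      (Pi.single (Fin.last n) 1) (z (Fin.last n)) := by
    rw [hasDerivAt_pi]
    intro j
    induction j using Fin.lastCases with
    | last =>
      simp only [Fin.snoc_last, Pi.single_eq_same]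
      exact hasDerivAt_id _
    | cast i =>
      simp only [Fin.snoc_castSucc, Pi.single_eq_of_ne (Fin.castSucc_ne_last i)]
      exact hasDerivAt_const _ _
  have hz : (Fin.snoc (Fin.init z) (z (Fin.last n)) : Fin (n + 1) → ℝ) = z := Fin.snoc_init_self z
  have hd' : HasFDerivAt F φ (Fin.snoc (Fin.init z) (z (Fin.last n))) := by rwa [hz]
  exact hd'.comp_hasDerivAt (z (Fin.last n)) h1

/-- Uniqueness: if also the fibre map has derivative `f z` (the Newton–Leibniz hypothesis), then
`φ e_last = f z`. [folklore] -/
theorem soloInformed_fderiv_single_last_eq {F : (Fin (n + 1) → ℝ) → ℝ}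
    {φ : (Fin (n + 1) → ℝ) →L[ℝ] ℝ} {z : Fin (n + 1) → ℝ} (hd : HasFDerivAt F φ z) {c : ℝ}
    (hfib : HasDerivAt (fun s : ℝ => F (Fin.snoc (Fin.init z) s)) c (z (Fin.last n))) :
    φ (Pi.single (Fin.last n) 1) = c :=
  (soloInformed_hasDerivAt_fibre hd).unique hfib

/-! ### Convex fibres -/

/-- The vertical fibre of a set over a base point. -/
def soloInformedFibre (D : Set (Fin (n + 1) → ℝ)) (x : Fin n → ℝ) : Set ℝ :=
  {t | (Fin.snoc x t : Fin (n + 1) → ℝ) ∈ D}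

/-- Membership in a fibre. -/
@[simp] theorem soloInformed_mem_fibre {D : Set (Fin (n + 1) → ℝ)} {x : Fin n → ℝ} {t : ℝ} :
    t ∈ soloInformedFibre D x ↔ (Fin.snoc x t : Fin (n + 1) → ℝ) ∈ D :=
  Iff.rfl

/-- A point lies on the fibre through it. -/
theorem soloInformed_last_mem_fibre {D : Set (Fin (n + 1) → ℝ)} {z : Fin (n + 1) → ℝ}
    (hz : z ∈ D) : z (Fin.last n) ∈ soloInformedFibre D (Fin.init z) := by
  rw [soloInformed_mem_fibre, Fin.snoc_init_self]
  exact hz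

/-- **Fibres of a band are convex** (intervals between the two boundary sections).
[BPR 2006, Def. 5.1] -/
theorem soloInformed_convex_fibre_bandOver (S : Set (Fin n → ℝ)) {l : ℕ}
    (ξ : Fin l → (Fin n → ℝ) → ℝ) (j : Fin (l + 1)) (x : Fin n → ℝ) :
    Convex ℝ (soloInformedFibre (bandOver S ξ j) x) := by
  rw [convex_iff_ordConnected]
  refine ⟨fun t₁ ht₁ t₂ ht₂ s hs => ?_⟩
  rw [soloInformed_mem_fibre, snoc_mem_bandOver_iff] at ht₁ ht₂ ⊢
  refine ⟨ht₁.1, lt_of_lt_of_le ht₁.2.1 (EReal.coe_le_coe_iff.2 hs.1),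
    lt_of_le_of_lt (EReal.coe_le_coe_iff.2 hs.2) ht₂.2.2⟩

/-- **Fibres of a slab `{(x,t) | x ∈ S, p x ≤ t ≤ q x}` are convex.** [folklore] -/
theorem soloInformed_convex_fibre_slab (S : Set (Fin n → ℝ)) (p q : (Fin n → ℝ) → ℝ)
    (x : Fin n → ℝ) :
    Convex ℝ (soloInformedFibre {z : Fin (n + 1) → ℝ | Fin.init z ∈ S ∧
      p (Fin.init z) ≤ z (Fin.last n) ∧ z (Fin.last n) ≤ q (Fin.init z)} x) := by
  rw [convex_iff_ordConnected]
  refine ⟨fun t₁ ht₁ t₂ ht₂ s hs => ?_⟩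
  simp only [soloInformed_mem_fibre, mem_setOf_eq, Fin.init_snoc, Fin.snoc_last] at ht₁ ht₂ ⊢
  exact ⟨ht₁.1, ht₁.2.1.trans hs.1, hs.2.trans ht₂.2.2⟩

/-! ### Injectivity from the sign of the vertical derivative -/

/-- **Strict fibrewise monotonicity from a positive vertical derivative on convex fibres.**
[folklore: mean value theorem] -/
theorem soloInformed_fibre_strictMono_of_pos {D : Set (Fin (n + 1) → ℝ)}
    (hconv : ∀ x, Convex ℝ (soloInformedFibre D x)) {F : (Fin (n + 1) → ℝ) → ℝ}
    {f : (Fin (n + 1) → ℝ) → ℝ}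
    (hd : ∀ z ∈ D, HasDerivAt (fun s : ℝ => F (Fin.snoc (Fin.init z) s)) (f z) (z (Fin.last n)))
    (hpos : ∀ z ∈ D, 0 < f z) {z z' : Fin (n + 1) → ℝ} (hz : z ∈ D) (hz' : z' ∈ D)
    (hinit : Fin.init z = Fin.init z') (hlt : z (Fin.last n) < z' (Fin.last n)) : F z < F z' := by
  have hdg : ∀ t ∈ soloInformedFibre D (Fin.init z),
      HasDerivAt (fun s : ℝ => F (Fin.snoc (Fin.init z) s)) (f (Fin.snoc (Fin.init z) t)) t := by
    intro t ht
    have h := hd _ ht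
    simp only [Fin.init_snoc, Fin.snoc_last] at h
    exact h
  have hmono : StrictMonoOn (fun s : ℝ => F (Fin.snoc (Fin.init z) s))
      (soloInformedFibre D (Fin.init z)) := by
    refine strictMonoOn_of_deriv_pos (hconv _)
      (fun t ht => (hdg t ht).continuousAt.continuousWithinAt) fun t ht => ?_
    have ht' : t ∈ soloInformedFibre D (Fin.init z) :=
      interior_subset (s := soloInformedFibre D (Fin.init z)) ht
    rw [(hdg t ht').deriv]
    exact hpos _ ht'
  have h1 : z (Fin.last n) ∈ soloInformedFibre D (Fin.init z) := soloInformed_last_mem_fibre hz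
  have h2 : z' (Fin.last n) ∈ soloInformedFibre D (Fin.init z) := by
    rw [hinit]; exact soloInformed_last_mem_fibre hz'
  have h := hmono h1 h2 hlt
  simp only at h
  rwa [Fin.snoc_init_self, hinit, Fin.snoc_init_self] at h

/-- **Strict fibrewise antitonicity from a negative vertical derivative.** [folklore] -/
theorem soloInformed_fibre_strictAnti_of_neg {D : Set (Fin (n + 1) → ℝ)}
    (hconv : ∀ x, Convex ℝ (soloInformedFibre D x)) {F : (Fin (n + 1) → ℝ) → ℝ}
    {f : (Fin (n + 1) → ℝ) → ℝ}
    (hd : ∀ z ∈ D, HasDerivAt (fun s : ℝ => F (Fin.snoc (Fin.init z) s)) (f z) (z (Fin.last n)))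
    (hneg : ∀ z ∈ D, f z < 0) {z z' : Fin (n + 1) → ℝ} (hz : z ∈ D) (hz' : z' ∈ D)
    (hinit : Fin.init z = Fin.init z') (hlt : z (Fin.last n) < z' (Fin.last n)) : F z' < F z := by
  have h := soloInformed_fibre_strictMono_of_pos hconv (F := fun w => -F w) (f := fun w => -f w)
    (fun w hw => (hd w hw).neg) (fun w hw => neg_pos.2 (hneg w hw)) hz hz' hinit hlt
  exact neg_lt_neg_iff.1 h

/-- **Injectivity of `Ψ_F` from `∂_t F > 0` on convex fibres.** [folklore] -/
theorem soloInformed_injOn_lastSubst_of_pos {D : Set (Fin (n + 1) → ℝ)}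
    (hconv : ∀ x, Convex ℝ (soloInformedFibre D x)) {F : (Fin (n + 1) → ℝ) → ℝ}
    {f : (Fin (n + 1) → ℝ) → ℝ}
    (hd : ∀ z ∈ D, HasDerivAt (fun s : ℝ => F (Fin.snoc (Fin.init z) s)) (f z) (z (Fin.last n)))
    (hpos : ∀ z ∈ D, 0 < f z) : InjOn (soloInformedLastSubst F) D :=
  soloInformed_injOn_lastSubst_of_strictMono fun _ hz _ hz' hinit hlt =>
    soloInformed_fibre_strictMono_of_pos hconv hd hpos hz hz' hinit hlt

/-- **Injectivity of `Ψ_F` from `∂_t F < 0` on convex fibres.** [folklore] -/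
theorem soloInformed_injOn_lastSubst_of_neg {D : Set (Fin (n + 1) → ℝ)}
    (hconv : ∀ x, Convex ℝ (soloInformedFibre D x)) {F : (Fin (n + 1) → ℝ) → ℝ}
    {f : (Fin (n + 1) → ℝ) → ℝ}
    (hd : ∀ z ∈ D, HasDerivAt (fun s : ℝ => F (Fin.snoc (Fin.init z) s)) (f z) (z (Fin.last n)))
    (hneg : ∀ z ∈ D, f z < 0) : InjOn (soloInformedLastSubst F) D :=
  soloInformed_injOn_lastSubst_of_strictAnti fun _ hz _ hz' hinit hlt =>
    soloInformed_fibre_strictAnti_of_neg hconv hd hneg hz hz' hinit hlt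

/-! ### Sheets -/

/-- The fibrewise Newton–Leibniz derivative of `F` from a Fréchet derivative `φ` with
`φ z e_last = ρ.integrand z`. -/
theorem soloInformed_hasDerivAt_fibre_of_eq {F : (Fin (n + 1) → ℝ) → ℝ}
    {φ : (Fin (n + 1) → ℝ) → (Fin (n + 1) → ℝ) →L[ℝ] ℝ} {D : Set (Fin (n + 1) → ℝ)}
    {f : (Fin (n + 1) → ℝ) → ℝ} (hd : ∀ z ∈ D, HasFDerivAt F (φ z) z)
    (hjac : ∀ z ∈ D, f z = φ z (Pi.single (Fin.last n) 1)) :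
    ∀ z ∈ D, HasDerivAt (fun s : ℝ => F (Fin.snoc (Fin.init z) s)) (f z) (z (Fin.last n)) :=
  fun z hz => hjac z hz ▸ soloInformed_hasDerivAt_fibre (hd z hz)

/-- Membership in the image `Ψ_F(D)`, fibrewise: `(x, y) ∈ Ψ_F(D)` iff `y = F (x, t)` for some
`t` in the fibre of `D` over `x`. -/
theorem soloInformed_mem_image_lastSubst_iff {F : (Fin (n + 1) → ℝ) → ℝ}
    {D : Set (Fin (n + 1) → ℝ)} {w : Fin (n + 1) → ℝ} :
    w ∈ soloInformedLastSubst F '' D ↔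
      w (Fin.last n) ∈ (fun t : ℝ => F (Fin.snoc (Fin.init w) t)) '' soloInformedFibre D (Fin.init w) := by
  constructor
  · rintro ⟨z, hz, rfl⟩
    refine ⟨z (Fin.last n), ?_, ?_⟩
    · rw [soloInformed_mem_fibre, soloInformed_init_lastSubst, Fin.snoc_init_self]
      exact hz
    · simp only [soloInformed_init_lastSubst, Fin.snoc_init_self, soloInformed_lastSubst_apply_last]
  · rintro ⟨t, ht, hw⟩
    simp only at hw
    refine ⟨Fin.snoc (Fin.init w) t, ht, ?_⟩
    rw [soloInformed_lastSubst_eq_snoc, Fin.init_snoc, hw, Fin.snoc_init_self]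

/-- **The positive sheet** `[Ψ_F(D), 1]` of a representation `ρ = [D, f]` with convex vertical
fibres, `F` `ℚ`-semialgebraic on `D` and differentiable at its points with `∂_t F = f > 0` on `D`
(injectivity of `Ψ_F` on `D` follows). [Kontsevich–Zagier 2001, §1.2, rules 2), 3)] -/
def soloInformedPosSheet (ρ : IntegralRep (n + 1)) (F : (Fin (n + 1) → ℝ) → ℝ)
    (φ : (Fin (n + 1) → ℝ) → (Fin (n + 1) → ℝ) →L[ℝ] ℝ) (hF : IsSemialgebraicFunOn ℚ ρ.domain F)
    (hd : ∀ z ∈ ρ.domain, HasFDerivAt F (φ z) z)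
    (hconv : ∀ x, Convex ℝ (soloInformedFibre ρ.domain x))
    (hjac : ∀ z ∈ ρ.domain, ρ.integrand z = φ z (Pi.single (Fin.last n) 1))
    (hpos : ∀ z ∈ ρ.domain, 0 < ρ.integrand z) : IntegralRep (n + 1) :=
  soloInformedLastSubstRep ρ F φ hF (fun z hz => (hd z hz).hasFDerivWithinAt)
    (soloInformed_injOn_lastSubst_of_pos hconv
      (soloInformed_hasDerivAt_fibre_of_eq hd hjac) hpos)
    fun z hz => by rw [← hjac z hz, abs_of_pos (hpos z hz)]

/-- The domain of the positive sheet is `Ψ_F(D)`. -/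
@[simp] theorem soloInformed_posSheet_domain (ρ : IntegralRep (n + 1))
    (F : (Fin (n + 1) → ℝ) → ℝ) (φ : (Fin (n + 1) → ℝ) → (Fin (n + 1) → ℝ) →L[ℝ] ℝ)
    (hF : IsSemialgebraicFunOn ℚ ρ.domain F) (hd : ∀ z ∈ ρ.domain, HasFDerivAt F (φ z) z)
    (hconv : ∀ x, Convex ℝ (soloInformedFibre ρ.domain x))
    (hjac : ∀ z ∈ ρ.domain, ρ.integrand z = φ z (Pi.single (Fin.last n) 1))
    (hpos : ∀ z ∈ ρ.domain, 0 < ρ.integrand z) :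
    (soloInformedPosSheet ρ F φ hF hd hconv hjac hpos).domain = soloInformedLastSubst F '' ρ.domain :=
  rfl

/-- The integrand of the positive sheet is `1`. -/
@[simp] theorem soloInformed_posSheet_integrand (ρ : IntegralRep (n + 1))
    (F : (Fin (n + 1) → ℝ) → ℝ) (φ : (Fin (n + 1) → ℝ) → (Fin (n + 1) → ℝ) →L[ℝ] ℝ)
    (hF : IsSemialgebraicFunOn ℚ ρ.domain F) (hd : ∀ z ∈ ρ.domain, HasFDerivAt F (φ z) z)
    (hconv : ∀ x, Convex ℝ (soloInformedFibre ρ.domain x))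
    (hjac : ∀ z ∈ ρ.domain, ρ.integrand z = φ z (Pi.single (Fin.last n) 1))
    (hpos : ∀ z ∈ ρ.domain, 0 < ρ.integrand z) :
    (soloInformedPosSheet ρ F φ hF hd hconv hjac hpos).integrand = fun _ => 1 :=
  rfl

/-- **Positive sheet relation**: `[D, f] − [Ψ_F(D), 1] ∈ relations₁₂`.
[Kontsevich–Zagier 2001, §1.2, rules 2), 3)] -/
theorem soloInformed_of_sub_of_posSheet_mem (ρ : IntegralRep (n + 1))
    (F : (Fin (n + 1) → ℝ) → ℝ) (φ : (Fin (n + 1) → ℝ) → (Fin (n + 1) → ℝ) →L[ℝ] ℝ)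
    (hF : IsSemialgebraicFunOn ℚ ρ.domain F) (hd : ∀ z ∈ ρ.domain, HasFDerivAt F (φ z) z)
    (hconv : ∀ x, Convex ℝ (soloInformedFibre ρ.domain x))
    (hjac : ∀ z ∈ ρ.domain, ρ.integrand z = φ z (Pi.single (Fin.last n) 1))
    (hpos : ∀ z ∈ ρ.domain, 0 < ρ.integrand z) :
    of ρ - of (soloInformedPosSheet ρ F φ hF hd hconv hjac hpos) ∈ soloInformedEquidimRelations :=
  soloInformed_of_sub_of_lastSubstRep_mem ρ F φ hF _ _ _

/-- The value of the positive sheet is that of `ρ`. -/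
theorem soloInformed_value_posSheet (ρ : IntegralRep (n + 1))
    (F : (Fin (n + 1) → ℝ) → ℝ) (φ : (Fin (n + 1) → ℝ) → (Fin (n + 1) → ℝ) →L[ℝ] ℝ)
    (hF : IsSemialgebraicFunOn ℚ ρ.domain F) (hd : ∀ z ∈ ρ.domain, HasFDerivAt F (φ z) z)
    (hconv : ∀ x, Convex ℝ (soloInformedFibre ρ.domain x))
    (hjac : ∀ z ∈ ρ.domain, ρ.integrand z = φ z (Pi.single (Fin.last n) 1))
    (hpos : ∀ z ∈ ρ.domain, 0 < ρ.integrand z) :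
    (soloInformedPosSheet ρ F φ hF hd hconv hjac hpos).value = ρ.value :=
  soloInformed_value_lastSubstRep ρ F φ hF _ _ _

/-- **The negative sheet** `[Ψ_F(D), 1]` of `ρ = [D, f]` when `∂_t F = f < 0` on `D`: the positive
sheet of `ρ.neg = [D, −f]` for the same `F` (now strictly decreasing on the fibres).
[Kontsevich–Zagier 2001, §1.2, rules 2), 3)] -/
def soloInformedNegSheet (ρ : IntegralRep (n + 1)) (F : (Fin (n + 1) → ℝ) → ℝ)
    (φ : (Fin (n + 1) → ℝ) → (Fin (n + 1) → ℝ) →L[ℝ] ℝ) (hF : IsSemialgebraicFunOn ℚ ρ.domain F)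
    (hd : ∀ z ∈ ρ.domain, HasFDerivAt F (φ z) z)
    (hconv : ∀ x, Convex ℝ (soloInformedFibre ρ.domain x))
    (hjac : ∀ z ∈ ρ.domain, ρ.integrand z = φ z (Pi.single (Fin.last n) 1))
    (hneg : ∀ z ∈ ρ.domain, ρ.integrand z < 0) : IntegralRep (n + 1) :=
  soloInformedLastSubstRep ρ.neg F φ hF (fun z hz => (hd z hz).hasFDerivWithinAt)
    (soloInformed_injOn_lastSubst_of_neg hconv
      (soloInformed_hasDerivAt_fibre_of_eq hd hjac) hneg)
    fun z hz => by
      rw [IntegralRep.integrand_neg, Pi.neg_apply, ← hjac z hz, abs_of_neg (hneg z hz)]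

/-- The domain of the negative sheet is `Ψ_F(D)`. -/
@[simp] theorem soloInformed_negSheet_domain (ρ : IntegralRep (n + 1))
    (F : (Fin (n + 1) → ℝ) → ℝ) (φ : (Fin (n + 1) → ℝ) → (Fin (n + 1) → ℝ) →L[ℝ] ℝ)
    (hF : IsSemialgebraicFunOn ℚ ρ.domain F) (hd : ∀ z ∈ ρ.domain, HasFDerivAt F (φ z) z)
    (hconv : ∀ x, Convex ℝ (soloInformedFibre ρ.domain x))
    (hjac : ∀ z ∈ ρ.domain, ρ.integrand z = φ z (Pi.single (Fin.last n) 1))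
    (hneg : ∀ z ∈ ρ.domain, ρ.integrand z < 0) :
    (soloInformedNegSheet ρ F φ hF hd hconv hjac hneg).domain = soloInformedLastSubst F '' ρ.domain :=
  rfl

/-- The integrand of the negative sheet is `1`. -/
@[simp] theorem soloInformed_negSheet_integrand (ρ : IntegralRep (n + 1))
    (F : (Fin (n + 1) → ℝ) → ℝ) (φ : (Fin (n + 1) → ℝ) → (Fin (n + 1) → ℝ) →L[ℝ] ℝ)
    (hF : IsSemialgebraicFunOn ℚ ρ.domain F) (hd : ∀ z ∈ ρ.domain, HasFDerivAt F (φ z) z)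
    (hconv : ∀ x, Convex ℝ (soloInformedFibre ρ.domain x))
    (hjac : ∀ z ∈ ρ.domain, ρ.integrand z = φ z (Pi.single (Fin.last n) 1))
    (hneg : ∀ z ∈ ρ.domain, ρ.integrand z < 0) :
    (soloInformedNegSheet ρ F φ hF hd hconv hjac hneg).integrand = fun _ => 1 :=
  rfl

/-- **Negative sheet relation**: `[D, f] + [Ψ_F(D), 1] ∈ relations₁₂` (from
`[D, −f] − [Ψ_F(D), 1] ∈ relations₁₂` and `[D, f] + [D, −f] ∈ relations₁₂`).
[Kontsevich–Zagier 2001, §1.2, rules 1)–3)] -/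
theorem soloInformed_of_add_of_negSheet_mem (ρ : IntegralRep (n + 1))
    (F : (Fin (n + 1) → ℝ) → ℝ) (φ : (Fin (n + 1) → ℝ) → (Fin (n + 1) → ℝ) →L[ℝ] ℝ)
    (hF : IsSemialgebraicFunOn ℚ ρ.domain F) (hd : ∀ z ∈ ρ.domain, HasFDerivAt F (φ z) z)
    (hconv : ∀ x, Convex ℝ (soloInformedFibre ρ.domain x))
    (hjac : ∀ z ∈ ρ.domain, ρ.integrand z = φ z (Pi.single (Fin.last n) 1))
    (hneg : ∀ z ∈ ρ.domain, ρ.integrand z < 0) :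
    of ρ + of (soloInformedNegSheet ρ F φ hF hd hconv hjac hneg) ∈ soloInformedEquidimRelations := by
  have h1 : of ρ.neg - of (soloInformedNegSheet ρ F φ hF hd hconv hjac hneg) ∈
      soloInformedEquidimRelations :=
    soloInformed_of_sub_of_lastSubstRep_mem ρ.neg F φ hF _ _ _
  have h2 := soloInformed_of_add_of_neg_mem_equidimRelations ρ
  have h3 := soloInformedEquidimRelations.sub_mem h2 h1
  convert h3 using 1
  abel

/-- The value of the negative sheet is `−ρ.value`. -/
theorem soloInformed_value_negSheet (ρ : IntegralRep (n + 1))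
    (F : (Fin (n + 1) → ℝ) → ℝ) (φ : (Fin (n + 1) → ℝ) → (Fin (n + 1) → ℝ) →L[ℝ] ℝ)
    (hF : IsSemialgebraicFunOn ℚ ρ.domain F) (hd : ∀ z ∈ ρ.domain, HasFDerivAt F (φ z) z)
    (hconv : ∀ x, Convex ℝ (soloInformedFibre ρ.domain x))
    (hjac : ∀ z ∈ ρ.domain, ρ.integrand z = φ z (Pi.single (Fin.last n) 1))
    (hneg : ∀ z ∈ ρ.domain, ρ.integrand z < 0) :
    (soloInformedNegSheet ρ F φ hF hd hconv hjac hneg).value = -ρ.value := by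
  rw [← IntegralRep.value_neg]
  exact soloInformed_value_lastSubstRep ρ.neg F φ hF _ _ _

end Summit.KontsevichZagierPeriods.KontsevichZagierPeriods.Theorems
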